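import Mathlib
import HarnessLib

/-!
# NE7AlmostProjection — AN ALMOST-IDEMPOTENT SELF-ADJOINT MATRIX IS NEAR A PROJECTION THAT COMMUTES WITH EVERYTHING COMMUTING WITH IT (continuous functional
# calculus of the indicator of `(1∕2, ∞)`; file S3b-1 of the `k`-uniform stabiliser lifting programme — the perturbation step of «almost commuting unitaries are
# near exactly commuting ones inside the C*-algebra they generate»)

Cell `pub-balaban`, rung (B)+1 sub-cell t4, lineage `b2b-balaban-t4-ne7b-p1` (row NE7b OWNER + CRUX PROVER; junction service for row NE7, ruling R-OWNER-149-1 (2)),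
generation 159.  Memo `t4/b2b-balaban-t4-ne7b-p1/g159/records/S3-BRIEF.md` §2 (b), §5.
WHAT ([folklore]; 0 def, 0 sorry; complex `n × n` matrices with the `L²`-operator norm, Mathlib's `IsSelfAdjoint` functional calculus).  For a self-adjoint `y` put
`Q := cfc χ y`, `χ = 𝟙_{(1∕2, ∞)}`: §1 `Q` is self-adjoint and idempotent (`proj_isSelfAdjoint`, `proj_mul_self`), and commutes with every `z` commuting with `y`
(`commute_proj`); §2 the spectrum of `y` is within `2‖y² − y‖` of `{0, 1}` (`abs_sq_sub_le_of_mem_spectrum`, `abs_ind_sub_le`), hence **`norm_proj_sub_le`**: `‖Q − y‖ ≤ 2‖y² − y‖` (so a self-adjoint `y` within `η` of a projection `P` has the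
projection `Q` within `2(3η + η²) + η` of `P`, commuting with the commutant of `y` — the form S3b consumes).
HONEST FRAMING (page 1): elementary finite-dimensional C*-algebra; nothing of Bałaban's; NOT (NEAR-FLAT_K), NOT NE7, NOT NE3; row NE7b NOT PRINTED ∕ NOT PROVED; spine 0∕9;
finite T⁴ rung (B)+1 — NOT infinite volume, NOT mass gap, NOT BetaPertH, NOT Clay.
-/

set_option autoImplicit false

open scoped Matrix.Norms.L2Operator

namespace Summit.QuantumFields.BalabanUV.T4Continuum.NE7AlmostProjection

noncomputable section

variable {n : Type} [Fintype n] [DecidableEq n]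

/-! ## §1 The spectral projection `𝟙_{(1/2,∞)}(y)` -/

/-- The indicator of `(1∕2, ∞)` is continuous on the (finite) real spectrum of a matrix. [folklore] -/
theorem continuousOn_ind (y : Matrix n n ℂ) : ContinuousOn (fun t : ℝ => if (1 : ℝ) / 2 < t then (1 : ℝ) else 0) (spectrum ℝ y) :=
  Set.Finite.continuousOn (Matrix.finite_real_spectrum (A := y)) _

/-- `𝟙_{(1/2,∞)}(y)` is self-adjoint. [folklore] -/
theorem proj_isSelfAdjoint (y : Matrix n n ℂ) : IsSelfAdjoint (cfc (fun t : ℝ => if (1 : ℝ) / 2 < t then (1 : ℝ) else 0) y) :=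
  cfc_predicate _ y

/-- `𝟙_{(1/2,∞)}(y)` is idempotent. [folklore] -/
theorem proj_mul_self (y : Matrix n n ℂ) :
    cfc (fun t : ℝ => if (1 : ℝ) / 2 < t then (1 : ℝ) else 0) y * cfc (fun t : ℝ => if (1 : ℝ) / 2 < t then (1 : ℝ) else 0) y
      = cfc (fun t : ℝ => if (1 : ℝ) / 2 < t then (1 : ℝ) else 0) y := by
  rw [← cfc_mul _ _ y (continuousOn_ind y) (continuousOn_ind y)]
  congr 1
  funext t
  split_ifs <;> simp

/-- `𝟙_{(1/2,∞)}(y)` commutes with every matrix commuting with `y`. [folklore] -/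
theorem commute_proj {y z : Matrix n n ℂ} (hz : Commute z y) :
    Commute z (cfc (fun t : ℝ => if (1 : ℝ) / 2 < t then (1 : ℝ) else 0) y) :=
  (hz.symm.cfc_real _).symm

/-! ## §2 An almost-idempotent self-adjoint matrix is near its spectral projection -/

/-- A point `t` of the real spectrum of a self-adjoint matrix `y` satisfies `|t² − t| ≤ ‖y² − y‖`. [folklore] -/
theorem abs_sq_sub_le_of_mem_spectrum [Nonempty n] {y : Matrix n n ℂ} (hy : IsSelfAdjoint y) {t : ℝ} (ht : t ∈ spectrum ℝ y) :
    |t ^ 2 - t| ≤ ‖y ^ 2 - y‖ := by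
  have hmap : t ^ 2 - t ∈ spectrum ℝ (cfc (fun s : ℝ => s ^ 2 - s) y) := by
    rw [cfc_map_spectrum (fun s : ℝ => s ^ 2 - s) y]
    exact ⟨t, ht, rfl⟩
  have hcfc : cfc (fun s : ℝ => s ^ 2 - s) y = y ^ 2 - y := by
    rw [cfc_sub (fun s : ℝ => s ^ 2) (fun s : ℝ => s) y, cfc_pow (fun s : ℝ => s) 2 y, cfc_id' ℝ y]
  rw [hcfc] at hmap
  have h := spectrum.subset_closedBall_norm (𝕜 := ℝ) (y ^ 2 - y) hmap
  rw [Metric.mem_closedBall, dist_zero_right, Real.norm_eq_abs] at h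
  exact h

/-- If `|t² − t| ≤ θ` then `t` is within `2θ` of `0` or of `1`, on the side the indicator chooses: `|𝟙_{(1/2,∞)}(t) − t| ≤ 2θ`. [folklore] -/
theorem abs_ind_sub_le {t θ : ℝ} (h : |t ^ 2 - t| ≤ θ) :
    |(if (1 : ℝ) / 2 < t then (1 : ℝ) else 0) - t| ≤ 2 * θ := by
  have hθ0 : 0 ≤ θ := (abs_nonneg _).trans h
  have hfac : t ^ 2 - t = t * (t - 1) := by ring
  rw [hfac, abs_mul] at h
  split_ifs with ht
  · -- `t > 1/2`: `|t| ≥ 1/2`, so `|t − 1| ≤ 2θ`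
    have h1 : 1 / 2 ≤ |t| := by rw [abs_of_pos (by linarith)]; linarith
    have h2 : |t - 1| * (1 / 2) ≤ θ := by nlinarith [abs_nonneg (t - 1), abs_nonneg t]
    rw [abs_sub_comm]
    linarith
  · -- `t ≤ 1/2`: `|t − 1| ≥ 1/2`, so `|t| ≤ 2θ`
    push Not at ht
    have h1 : 1 / 2 ≤ |t - 1| := by rw [abs_of_nonpos (by linarith)]; linarith
    have h2 : |t| * (1 / 2) ≤ θ := by nlinarith [abs_nonneg (t - 1), abs_nonneg t]
    rw [zero_sub, abs_neg]
    linarith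

/-- **AN ALMOST-IDEMPOTENT SELF-ADJOINT MATRIX IS NEAR A PROJECTION**: `‖𝟙_{(1/2,∞)}(y) − y‖ ≤ 2‖y² − y‖` (no smallness needed: `max(|t|,|t−1|) ≥ 1∕2`). [folklore] -/
theorem norm_proj_sub_le [Nonempty n] {y : Matrix n n ℂ} (hy : IsSelfAdjoint y) :
    ‖cfc (fun t : ℝ => if (1 : ℝ) / 2 < t then (1 : ℝ) else 0) y - y‖ ≤ 2 * ‖y ^ 2 - y‖ := by
  have hsub : cfc (fun t : ℝ => (if (1 : ℝ) / 2 < t then (1 : ℝ) else 0) - t) y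
      = cfc (fun t : ℝ => if (1 : ℝ) / 2 < t then (1 : ℝ) else 0) y - y := by
    rw [cfc_sub (fun t : ℝ => if (1 : ℝ) / 2 < t then (1 : ℝ) else 0) (fun t : ℝ => t) y (continuousOn_ind y)
      (continuous_id.continuousOn), cfc_id' ℝ y]
  rw [← hsub]
  refine norm_cfc_le (by positivity) fun t ht => ?_
  rw [Real.norm_eq_abs]
  exact abs_ind_sub_le (abs_sq_sub_le_of_mem_spectrum hy ht)

end

end Summit.QuantumFields.BalabanUV.T4Continuum.NE7AlmostProjection
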